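import Literature.MathematicalPhysics.QuantumFieldTheory.Balaban1983to89.B9Eq3119DeltaPiTower
import Literature.MathematicalPhysics.QuantumFieldTheory.Balaban1983to89.B9Eq3115QkGaugeModeTower

/-!
# `Balaban1983to89.B9Eq3124PiIdentitiesTowerClosed` — T. Bałaban, *Propagators for lattice gauge theories in a background field*, Commun. Math. Phys. **99**
# (1985) 389–434 [Balaban1985BackgroundPropagators] (3.124) p. 420 with (3.115) p. 418, (3.122) p. 420, (3.153) p. 426, and [Balaban1985Variational] p. 294
# («Q𝔊 = 0, RD*𝔊 = 0»): **PRINT's DEFINING IDENTITIES OF THE THIRD GREEN's FUNCTION HOLD FOR THE `k`-TH-STEP LETTER `𝔊̃_k(U)` OF PRINT's OPERATOR (3.122)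
# (`B9Eq3119DeltaPiTower.laplaceAkPi`, NAMED) WITH NO DISPLAYED LETTER** — `Q_k(U)(𝔊̃_k(U)x) = 0`, `R_k(U)D*_U(𝔊̃_k(U)x) = 0` and, for print's minimiser
# (3.126) `H̃_k = G̃Q*(QG̃Q*)⁻¹`, `Q_k(U)(H̃_k(U)b) = b`, `R_k(U)D*_U(H̃_k(U)b) = 0` given only the positivity ∕ onto witnesses (and, for the `R D*` rows, unitarity +
# the trace letters): the owner's (g2)-modulo identities `B9Eq3119DeltaPiTower.Q_frakGLatticeK_pi` ∕ `RDstar_frakGLatticeK_pi` ∕ `laplaceAkPi_gaugeMode_h124′`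
# with (g2) = (3.115) INHABITED by ne9-leaf-02's `B9Eq3115QkGaugeModeTower.QkW_covDerivL2K_eq_zero_of_QprimeTowerW_eq_zero`

statement-level skeleton of published theorems with citation tags; proofs where landed; nothing here is a claim about the Yang–Mills mass gap

CITATION HEADER (lean-in-tree rule).  Audit cell `pub-balaban`, sub-cell `t4`, BINDER row NE9; filed by the row OWNER lineage `b2b-balaban-t4-ne9-p1`
(gen 88, plan v8 — the certificate that the letters the π-junction `B9Eq3126EnergyBallTowerPiClosed` bounds ARE print's: they satisfy print's constraints).
Sources READ first-hand by this lineage in the held text layer [Balaban1985BackgroundPropagators] (`paper:balaban1985-cmp99-background-propagators`, journal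
page = PDF page + 388) pp. 418–420, 426; [Balaban1985Variational] p. 294.

THE PRINT (verbatim, text layer).  [B9] p. 420: *«Let us notice that QG̃DR = 0, RD*G̃Q* = 0, RD*G̃DR = R. (3.124)»*; p. 420: *«… on configurations A satisfying
QA = B … H B = G̃Q*(QG̃Q*)⁻¹B. (3.126)»*; p. 418, after (3.115): *«… hence the averaging operation Q is invariant with respect to these transformations»*; [B11]
p. 294: *«… the operator 𝔊 … satisfies Q𝔊 = 0, RD*𝔊 = 0»*; [B11] (45) p. 285: the minimiser under `QA = B` in the gauge `RD*A = 0`.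

WHY THIS FILE (cell context; DIAGNOSIS D-ne9p1-g87-1).  The chain's `G₀`-slot letters satisfy (3.124) only at the flat point ((g1) fails off-shell); print's
letters — those of `laplaceAkPi` — satisfy them by construction MODULO the one displayed letter (g2) = (3.115) (`B9Eq3119DeltaPiTower`, gen 87).  ne9-leaf-02
g67 landed (3.115) at the chain's letters (`B9Eq3115QkGaugeModeTower`, p359427 ✓) in EXACTLY the (g2) shape.  THIS file composes the two: the identities that
make print's `𝔊` print's hold for the NAMED `k`-th-step letter with no displayed letter — the companion certificate of the π-junction (which bounds these
letters) for the consumer that identifies them with Bałaban's 𝐇_k-data (O-NE9-1 #5).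

WHAT IS PROVED (sorry-free; 0 `def`; [folklore] four one-line compositions BY NAME).  For E162's per-level data `(αU, hα1, hU1, hreg)`, ANY site witness
`hpos′`, ANY positivity witness `hpos₁` of `laplaceAkPi L m n φ τ η U a′ hpos′ hL αU hα1 hU1 hreg a` and ANY onto-witness `hQ` of `Q_k(U)`:
* **`QkW_frakGLatticeK_pi_eq_zero`** — `Q_k(U)(𝔊̃_k(U)x) = 0` for all `x` ([B11] p. 294 «Q𝔊 = 0»; [B9] (3.124) first member).
* **`RofUk_covDivL2K_frakGLatticeK_pi_eq_zero`** — for unitary `U` (`U(b)* = U(b)⁻¹`), a `*`-trace `τ` and the cell's norming `⟪φ⁻¹X, φ⁻¹Y⟫ = τ(X*Y)`: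
  `R_k(U)(D*_U(𝔊̃_k(U)x)) = 0` for all `x` ([B11] p. 294 «RD*𝔊 = 0»; [B9] (3.124) second ∕ third members).
* **`QkW_H1LatticeK_pi_eq`** — `Q_k(U)(H̃_k(U)b) = b` (the constraint `QA = B`; hypothesis-free on the letters, recorded for the consumer next to the gauge row).
* **`RofUk_covDivL2K_H1LatticeK_pi_eq_zero`** — unitary `U`, `*`-trace, norming: `R_k(U)(D*_U(H̃_k(U)b)) = 0` — print's minimiser (3.126) satisfies the gauge
  condition `RD*A = 0` of [B11] (45) ((3.124) `RD*G̃Q* = 0` at `y = (QG̃Q*)⁻¹b`; `H̃ = G̃ ∘ Q† ∘ K̃⁻¹` by `H1LatticeK_eq`).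
HONEST SCOPE.  Exact algebra on constructed objects; no estimate, no window, no constant; the witnesses `hpos′`, `hpos₁`, `hQ` stay DISPLAYED (inhabited on the
diagonal by `B9Thm311SitePrimeFormCoerciveTowerCanonical`, `B9Thm311LaplaceAkPiPositiveDiagonal`, `QkW_surjective`); nothing of [B9]∕[B11] asserted beyond the
quoted sentences.  NOT summit progress (cell pub-balaban: NE9 NOT PRINTED ∕ NOT PROVED; «NE9 ⇐ the named binders»; row WALLED ON A MODEL (O-NE9-1; #5
UNRULED); spine PROVED 0∕9; rung (B)+1 finite T⁴ — NOT infinite volume, NOT mass gap, NOT BetaPertH, NOT Clay).  HONEST DEPENDENCY (cell line): continuum YM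
on T⁴ ⇐ BetaPertH ∧ nine spine estimates (0/9 proved); BetaPertH ⇐ (D1) ∧ (D4) ∧ CAP+tail; G-an2-4 gates asym, D1 and NE2/3/4.  NEW file; nothing modified.
Net new unproved facts: 0.
-/

noncomputable section

open scoped InnerProductSpace ComplexConjugate BigOperators

namespace Literature.MathematicalPhysics.QuantumFieldTheory.Balaban1983to89.B9Eq3124PiIdentitiesTowerClosed

open B4Sect5Torus (TSite)
open B9SectCLatticeCarrier (Bond)
open B11Eq103H1Complex (SiteL2K BondL2K covDerivL2K covDivL2K frakGLatticeK H1LatticeK KinvLatticeK H1LatticeK_eq Q_H1LatticeK)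
open B9Eq310HessianOperator (adTransportW)
open B9Eq315QTorus (perCfg cornerSite)
open B9Eq315QTower (towerP UlevOf)
open B9Eq326OperatorTower (QprimeTowerW QkW RofUk)
open B9Eq324DeltaPrimeATower (laplacePrimeAk)
open B9Eq3119DeltaPiTower (laplaceAkPi Q_frakGLatticeK_pi RDstar_frakGLatticeK_pi laplaceAkPi_gaugeMode_h124')
open B9Eq3115QkGaugeModeTower (QkW_covDerivL2K_eq_zero_of_QprimeTowerW_eq_zero)
open B7Prop1Explicit (U1 Wcx boxVec)

variable {d : ℕ} (L : ℕ) [NeZero L] (m : Fin d → ℕ) [∀ i, NeZero (m i)] (n : ℕ)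
  {𝔸 : Type*} [NormedRing 𝔸] [NormedAlgebra ℂ 𝔸] [CompleteSpace 𝔸] [NormOneClass 𝔸] [StarRing 𝔸] [StarModule ℂ 𝔸]
  {W : Type*} [NormedAddCommGroup W] [InnerProductSpace ℂ W] [FiniteDimensional ℂ W] (φ : W ≃ₗ[ℂ] 𝔸) {c₀ : ℝ} [Fact (0 < c₀)]
  (τ : 𝔸 →ₗ[ℂ] ℂ) (η : ℝ) (U : Bond d (towerP L m (n + 1)) → 𝔸ˣ)
  {c₁ : ℝ} [Fact (0 < c₁)] (a' : ℝ)
  (hpos' : ∀ x : SiteL2K ℂ d (towerP L m (n + 1)) c₀ W, x ≠ 0 → 0 < RCLike.re ⟪x, laplacePrimeAk L m n φ η U a' (c₁ := c₁) x⟫_ℂ)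
  (hL : 1 ≤ L) (αU : ℕ → ℝ) (hα1 : ∀ j, αU j ≤ 1 / 64)
  (hU1 : ∀ (j : ℕ) (x : B7Prop1Explicit.Site d) (κ : Fin d), perCfg (towerP L m (j + 1)) (UlevOf L m (n + 1) U j) x κ ∈ U1 𝔸)
  (hreg : ∀ (j : ℕ) (y : TSite d (towerP L m j)) (κ : Fin d) (r : Fin d → Fin L),
    ‖((Wcx L (perCfg (towerP L m (j + 1)) (UlevOf L m (n + 1) U j)) (cornerSite L y) κ (boxVec L r) : 𝔸ˣ) : 𝔸) - 1‖ ≤ αU j)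
  {a : ℝ}
  (hpos₁ : ∀ x : BondL2K ℂ d (towerP L m (n + 1)) c₀ W, x ≠ 0 →
    0 < RCLike.re ⟪x, laplaceAkPi L m n φ τ η U a' hpos' hL αU hα1 hU1 hreg (c₁ := c₁) a x⟫_ℂ)
  (hQ : Function.Surjective (QkW L m n φ U hL αU hα1 hU1 hreg (c₀ := c₀) (c₁ := c₁)))

/-- **`Q_k(U)(𝔊̃_k(U)x) = 0` WITH NO DISPLAYED LETTER** — print's «Q𝔊 = 0» for the `k`-th-step letter of print's operator (3.122): the owner's
`Q_frakGLatticeK_pi` with (g2) = (3.115) supplied by ne9-leaf-02's `QkW_covDerivL2K_eq_zero_of_QprimeTowerW_eq_zero`. [folklore]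
[cite: Balaban1985Variational, (110)–(111) p.294; Balaban1985BackgroundPropagators, (3.124) p.420, (3.115) p.418, (3.153) p.426] -/
theorem QkW_frakGLatticeK_pi_eq_zero (x : BondL2K ℂ d (towerP L m (n + 1)) c₀ W) :
    QkW L m n φ U hL αU hα1 hU1 hreg (c₀ := c₀) (c₁ := c₁) (frakGLatticeK hpos₁ hQ x) = 0 :=
  Q_frakGLatticeK_pi L m n φ τ η U a' hpos' hL αU hα1 hU1 hreg hpos₁
    (fun l hl => QkW_covDerivL2K_eq_zero_of_QprimeTowerW_eq_zero φ η L m n hL U αU hα1 hU1 hreg (c₀ := c₀) (c₁ := c₁) l hl) hQ x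

/-- **`R_k(U)(D*_U(𝔊̃_k(U)x)) = 0` WITH NO DISPLAYED LETTER** (unitary `U`, `*`-trace, the cell's norming) — print's «RD*𝔊 = 0» for the `k`-th-step letter of
print's operator: the owner's `RDstar_frakGLatticeK_pi` with (g2) supplied likewise. [folklore]
[cite: Balaban1985Variational, (110)–(111) p.294; Balaban1985BackgroundPropagators, (3.124) p.420, (3.115) p.418] -/
theorem RofUk_covDivL2K_frakGLatticeK_pi_eq_zero (hU : ∀ b, star (U b : 𝔸) = ((U b)⁻¹ : 𝔸ˣ)) (hτ₁ : ∀ X : 𝔸, τ (star X) = conj (τ X))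
    (hτ₂ : ∀ X Y : 𝔸, τ (X * Y) = τ (Y * X)) (hφ : ∀ X Y : 𝔸, ⟪φ.symm X, φ.symm Y⟫_ℂ = τ (star X * Y))
    (x : BondL2K ℂ d (towerP L m (n + 1)) c₀ W) :
    RofUk L m n φ η U (covDivL2K ℂ c₀ ((η : ℂ))⁻¹ (adTransportW φ fun b => (U b)⁻¹) (frakGLatticeK hpos₁ hQ x)) = 0 :=
  RDstar_frakGLatticeK_pi L m n φ τ η U a' hpos' hL αU hα1 hU1 hreg hpos₁
    (fun l hl => QkW_covDerivL2K_eq_zero_of_QprimeTowerW_eq_zero φ η L m n hL U αU hα1 hU1 hreg (c₀ := c₀) (c₁ := c₁) l hl) hQ hU hτ₁ hτ₂ hφ x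

/-- **`Q_k(U)(H̃_k(U)b) = b`** — the constraint `QA = B` for print's minimiser (3.126), hypothesis-free on the letters (`B11Eq103H1Complex.Q_H1LatticeK`);
recorded next to the gauge row for the consumer. [cite: Balaban1985BackgroundPropagators, (3.126) p.420; Balaban1985Variational, (45) p.285] -/
theorem QkW_H1LatticeK_pi_eq (b : BondL2K ℂ d m c₁ W) :
    QkW L m n φ U hL αU hα1 hU1 hreg (c₀ := c₀) (c₁ := c₁) (H1LatticeK hpos₁ hQ b) = b :=
  Q_H1LatticeK hpos₁ hQ b

/-- **`R_k(U)(D*_U(H̃_k(U)b)) = 0` WITH NO DISPLAYED LETTER** (unitary `U`, `*`-trace, the cell's norming) — print's minimiser (3.126) `H̃ = G̃Q*(QG̃Q*)⁻¹`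
satisfies the gauge condition `RD*A = 0` of [B11] (45): (3.124) `RD*G̃Q* = 0` (`laplaceAkPi_gaugeMode_h124′`, (g2) supplied by ne9-leaf-02's bridge) at
`y = (QG̃Q*)⁻¹b`, `H̃ = G̃ ∘ Q† ∘ K̃⁻¹` by `rfl`. [folklore] [cite: Balaban1985BackgroundPropagators, (3.124) p.420, (3.126) p.420, (3.115) p.418; Balaban1985Variational, (45) p.285] -/
theorem RofUk_covDivL2K_H1LatticeK_pi_eq_zero (hU : ∀ b, star (U b : 𝔸) = ((U b)⁻¹ : 𝔸ˣ)) (hτ₁ : ∀ X : 𝔸, τ (star X) = conj (τ X))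
    (hτ₂ : ∀ X Y : 𝔸, τ (X * Y) = τ (Y * X)) (hφ : ∀ X Y : 𝔸, ⟪φ.symm X, φ.symm Y⟫_ℂ = τ (star X * Y))
    (b : BondL2K ℂ d m c₁ W) :
    RofUk L m n φ η U (covDivL2K ℂ c₀ ((η : ℂ))⁻¹ (adTransportW φ fun b => (U b)⁻¹) (H1LatticeK hpos₁ hQ b)) = 0 := by
  rw [H1LatticeK_eq, LinearMap.comp_apply, LinearMap.comp_apply]
  exact laplaceAkPi_gaugeMode_h124' L m n φ τ η U a' hpos' hL αU hα1 hU1 hreg hpos₁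
    (fun l hl => QkW_covDerivL2K_eq_zero_of_QprimeTowerW_eq_zero φ η L m n hL U αU hα1 hU1 hreg (c₀ := c₀) (c₁ := c₁) l hl) hU hτ₁ hτ₂ hφ
    (KinvLatticeK hpos₁ hQ b)

end Literature.MathematicalPhysics.QuantumFieldTheory.Balaban1983to89.B9Eq3124PiIdentitiesTowerClosed

end
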